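import Literature.NumberTheory.EllipticCurves.FineSelmerClassGroupCriterion

/-!
# Sketch (k1 g16) — crux `SignedMuSeedAtTwoPlus` (stmt-BirchSwinnertonDyer-21438), idea `gras-leopoldt-split`

First lemmas of the line «(F) = GRAS-μ ∧ LEOPOLDT-μ; the Gras factor is certified by ONE level of
non-squareness of the ρ-elliptic unit and attacked by explicit reciprocity for roots of Robert units;
the Leopoldt factor (μ of the saturation defect of cubic units at the dyadic prime) is the residue».
Nothing here proves BSD or the crux; `FTarget` is the (F)-half of the crux in tree language
(E1 `CubicMuExact` / k2g10 S3: crux ⟸ (F) ∧ (P⁺)).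
-/

namespace Summit.BirchSwinnertonDyer.BirchSwinnertonDyer.Cruxes.SignedMuSeedAtTwoPlus.GrasLeopoldtSplit

open Literature.NumberTheory.EllipticCurves Literature.NumberTheory.IwasawaTheory

/-- The (F)-half of the crux, tree form: classical `μ₂ = 0` (growth form) for the cyclotomic
`ℤ₂`-extension of `M = ℚ(W[2])` (S₃-sextic).  The line proves `FTarget W` as the conjunction of a
GRAS factor (`μ(Ē^ρ_∞ / C̄^ρ_∞) = 0`: ρ-elliptic units are not Λ-adic squares of global units) and a
LEOPOLDT factor (`μ(t(U′^ρ_∞ / Ē^ρ_∞)) = 0`: global ρ-units are not Λ-adically local squares at the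
dyadic prime), glued by `reducedCoordinate_ne_zero_iff` below. -/
abbrev FTarget (W : WeierstrassCurve ℚ) [W.IsElliptic] : Prop :=
  ∀ κF : ZpExtension (W.divisionField 2) 2, κF.IsCyclotomic → ClassicalMuVanishes κF

/-- FL2 (factorisation core, PROVED).  Over the residue domain `R = Λ′/2Λ′ = 𝔽₄[[T]]` the reduced
elliptic-unit coordinate of k2g10 (T3–T5) is `ā = (ḡ·f̄₀) • ē`, where `e ∈ Λ′²` generates the
saturation of the global ρ-units inside the free local module `U′^ρ_∞ ≅ Λ′²` (content one, so
`ē ≠ 0`), `g` is the characteristic content of the Leopoldt saturation defect `t(U′/Ē) ≅ Λ′/(g)`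
(no finite submodule in `t𝔛_∞` ⇒ `Ē^ρ = g·Λ′e` is free) and `f₀ = char(Ē/C̄)`.  Hence
(F) ⟺ `ā ≠ 0` ⟺ `ḡ ≠ 0 ∧ f̄₀ ≠ 0` ⟺ LEOPOLDT-μ = 0 ∧ GRAS-μ = 0. -/
theorem reducedCoordinate_ne_zero_iff {R : Type*} [CommRing R] [IsDomain R]
    (g f₀ : R) (e : Fin 2 → R) (he : e ≠ 0) :
    (g * f₀) • e ≠ 0 ↔ g ≠ 0 ∧ f₀ ≠ 0 := by
  rw [Ne, smul_eq_zero, mul_eq_zero]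
  tauto

/-- FL1 (one level certifies the Gras factor — tower form; TRUE, proof = König's lemma on the
inverse system of the two-element sets `{θ : θ² = ζ_m}`).  `E m` = ρ-relevant unit group of the
`m`-th layer `M_m`, `N m` = norm `M_{m+1} → M_m`, `t m = −1` (the only non-trivial square root of
unity: `i ∉ M_m`; `N(−1) = 1` in even degree).  If the norm-coherent elliptic unit `ζ` is `±` a square
at EVERY level then it is the square of a NORM-COHERENT family, i.e. `ζ ∈ 2·Ē_∞` (additive notation)
and the Gras factor `f̄₀` vanishes.  Contrapositive = the finite certificate GNS(m):
`u_m := ζ_m² /(ζ_m^σ ζ_m^{σ²}) ∉ ±M_m^{×2}` at ONE level `m` ⇒ GRAS-μ = 0 for the class. -/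
theorem normCoherent_sqrt
    (E : ℕ → Type*) [∀ m, CommGroup (E m)] (N : ∀ m, E (m + 1) →* E m)
    (t : ∀ m, E m) (htN : ∀ m, N m (t (m + 1)) = 1)
    (hroots : ∀ m (x : E m), x ^ 2 = 1 → x = 1 ∨ x = t m)
    (ζ : ∀ m, E m) (hζ : ∀ m, N m (ζ (m + 1)) = ζ m)
    (hsq : ∀ m, ∃ η : E m, ζ m = η ^ 2 ∨ ζ m = t m * η ^ 2) :
    ∃ θ : ∀ m, E m, (∀ m, N m (θ (m + 1)) = θ m) ∧ ∀ m, ζ m = θ m ^ 2 := by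
  sorry

/-- FL3 (every level below a square level is an honest square level; the elementary half of FL1,
PROVED): if `ζ_{m+1}` is `±` a square then `ζ_m = N(ζ_{m+1})` is a square. -/
theorem isSquare_of_succ
    (E : ℕ → Type*) [∀ m, CommGroup (E m)] (N : ∀ m, E (m + 1) →* E m)
    (t : ∀ m, E m) (htN : ∀ m, N m (t (m + 1)) = 1)
    (ζ : ∀ m, E m) (hζ : ∀ m, N m (ζ (m + 1)) = ζ m) (m : ℕ)
    (hsq : ∃ η : E (m + 1), ζ (m + 1) = η ^ 2 ∨ ζ (m + 1) = t (m + 1) * η ^ 2) :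
    ∃ θ : E m, ζ m = θ ^ 2 := by
  obtain ⟨η, h | h⟩ := hsq
  · exact ⟨N m η, by rw [← hζ m, h, map_pow]⟩
  · exact ⟨N m η, by rw [← hζ m, h, map_mul, htN m, one_mul, map_pow]⟩

end Summit.BirchSwinnertonDyer.BirchSwinnertonDyer.Cruxes.SignedMuSeedAtTwoPlus.GrasLeopoldtSplit
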